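import Summits.CriticalPhenomena.PercolationContinuityZ3.Theses.PercAnnulusCrossing
import Summits.CriticalPhenomena.PercolationContinuityZ3.Theorems.PercNonProliferationSubpolynomialBlockingStubTiling
import Summits.CriticalPhenomena.PercolationContinuityZ3.Theorems.PercNonProliferationSubpolynomialBlockingStubSixSlab
import Summits.CriticalPhenomena.PercolationContinuityZ3.Theorems.SubpolynomialBlocking.Negative.Strengthenings
import HarnessLib

/-!
# Crux `PercNonProliferation.SubpolynomialBlocking` (stmt-CriticalPhenomena-4446), line `cross-sandwich-flat-seal` — stub `stub_blockerRSWGlue`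

Helper file for the lead's skeleton of the line `cross-sandwich-flat-seal` of the crux
`Summit.CriticalPhenomena.PercolationContinuityZ3.Theses.PercNonProliferation.SubpolynomialBlocking`.
Proves exactly the registered stub signature `stub_blockerRSWGlue`; lands with
`--supports stmt-CriticalPhenomena-4446`. The signature is, character for character, the body of the
sibling route item `Theses.PercAnnulusCrossing.BlockerRSWGlue` (with the `Literature.…` prefixes
opened): `BlockerRSW3D → CubeBlockingSeed → CritAnnulusNonCrossing`
(`StubBlockerRSWGlue.critAnnulusNonCrossing_of`).

Write `seal₀(Icc a b)` for "NO open path inside the coordinate box `Icc a b ⊆ ℤ³` from its face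
`{x₀ = a₀}` to its face `{x₀ = b₀}`" (the complement of an `openCrossing` event), and at `p = p_c(ℤ³)`:
`q_n = P(seal₀([0,n]³))` (cube), `w_n = P(seal₀([0,n] × [0,2n]²))` (wide box),
`V_n = P(seal₀([n,2n] × [-2n,2n]²))` (face slab of the shell `Λ_{2n} ∖ Λ_n`) and
`u_n = blockProb 3 p_c n = 1 - P(annulusCrossing 3 n)` (no open path of `Λ_{2n}` from `Λ_n` to
`∂ⁱⁿΛ_{2n}`).

## The argument (pure bookkeeping over three landed facts)

* HYPOTHESES. `BlockerRSW3D`: one monotone `f` with `f > 0` on `(0, ∞)` and `f(q_n(p)) ≤ w_n(p)` for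
  all `p`, `n ≥ 1`; `CubeBlockingSeed`: `c₀ ≤ q_n` at `p_c` for `n ≥ 1`, `c₀ > 0`. Hence, at `p_c`,
  `b := f(c₀) ≤ f(q_n) ≤ w_n` with `b > 0` (`StubBlockerRSWGlue.sealEvent_eq` identifies the items'
  `Finset.Icc` spelling of the seal events with the line's `Set.Icc`/`openCrossing` spelling).
* LARGE `n`. The landed tiling stub at aspect `k = 1` (`stub_tiling`, p80188; its box
  `[0,n] × [0, n + n/1]²` is the wide box, `StubBlockerRSWGlue.tiling_one`) gives `K, N` with
  `w_n ^ K ≤ V_n` for `n ≥ N`, and the landed six-slab stub (`stub_sixSlab`, p82361) gives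
  `V_n ^ 6 ≤ u_n`; so `(b ^ K) ^ 6 ≤ u_n` for `n ≥ max N 1`.
* SMALL `n`. For `1 ≤ n ≤ N`, `u_n > 0` (`Negative.blockProb_criticalProb_three_pos`, p73922), a
  finite minimum (`StubBlockerRSWGlue.exists_pos_forall_le_blockProb`, induction on `N`).
* Conclude with `c := min ((b ^ K) ^ 6) c₁` and `u_n = 1 - P(annulusCrossing 3 n)`
  (`Negative.blockProb_eq`); the conclusion's event IS `annulusCrossing 3 n` (definitional).

No new definitions.
-/

noncomputable section

namespace Summit.CriticalPhenomena.PercolationContinuityZ3.Theorems.SubpolynomialBlocking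

open MeasureTheory Filter Topology
open Literature.Probability.Percolation Literature.Probability.LatticeModels
open Literature.Barriers.CriticalPhenomena
open Summit.CriticalPhenomena.PercolationContinuityZ3.Theses
open Summit.CriticalPhenomena.PercolationContinuityZ3.Theorems.SubpolynomialBlocking.Negative

namespace StubBlockerRSWGlue

/-- The items' `Finset.Icc` spelling of "the box `[0, b]` is sealed across direction `0` between the
faces `{x₀ = 0}` and `{y₀ = t}`" is the line's `Set.Icc`/`openCrossing` spelling (same set). -/
theorem sealEvent_eq (b : Site 3) (t : ℤ) :
    {ω : BondConfig (Site 3) | ¬ ∃ x ∈ Finset.Icc (0 : Site 3) b, ∃ y ∈ Finset.Icc (0 : Site 3) b,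
        x 0 = 0 ∧ y 0 = t ∧ ω ∈ openConnIn ↑(Finset.Icc (0 : Site 3) b) x y} =
      (openCrossing (Set.Icc (0 : Site 3) b) {x | x ∈ Set.Icc (0 : Site 3) b ∧ x 0 = 0}
        {y | y ∈ Set.Icc (0 : Site 3) b ∧ y 0 = t})ᶜ := by
  -- adapted from the scratch `cubeSealEvent_eq` of the sibling stub `stub_anchor`
  ext ω
  simp only [Set.mem_compl_iff, mem_openCrossing_iff, Set.mem_setOf_eq, Finset.coe_Icc,
    Finset.mem_Icc, Set.mem_Icc]
  constructor
  · rintro h ⟨x, ⟨hx, hx0⟩, y, ⟨hy, hy0⟩, hω⟩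
    exact h ⟨x, hx, y, hy, hx0, hy0, hω⟩
  · rintro h ⟨x, hx, y, hy, hx0, hy0, hω⟩
    exact h ⟨x, ⟨hx, hx0⟩, y, ⟨hy, hy0⟩, hω⟩

/-- The tiling stub at aspect `k = 1`: its seed box `[0,n] × [0, n + n/1]²` is the wide box
`[0,n] × [0,2n]²`, so `w_n ^ K ≤ V_n` for `n ≥ N`. -/
theorem tiling_one :
    ∃ K N : ℕ, ∀ n : ℕ, N ≤ n →
      (bondPercolation (zdGraph 3) (criticalProbI 3)).real
          (openCrossing (Set.Icc (0 : Site 3) ![(n : ℤ), 2 * n, 2 * n])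
            {x | x ∈ Set.Icc (0 : Site 3) ![(n : ℤ), 2 * n, 2 * n] ∧ x 0 = 0}
            {y | y ∈ Set.Icc (0 : Site 3) ![(n : ℤ), 2 * n, 2 * n] ∧ y 0 = (n : ℤ)})ᶜ ^ K ≤
        (bondPercolation (zdGraph 3) (criticalProbI 3)).real
          (openCrossing (Set.Icc (![(n : ℤ), -(2 * (n : ℤ)), -(2 * (n : ℤ))] : Site 3)
              ![2 * (n : ℤ), 2 * (n : ℤ), 2 * (n : ℤ)])
            {x | x ∈ Set.Icc (![(n : ℤ), -(2 * (n : ℤ)), -(2 * (n : ℤ))] : Site 3)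
              ![2 * (n : ℤ), 2 * (n : ℤ), 2 * (n : ℤ)] ∧ x 0 = (n : ℤ)}
            {y | y ∈ Set.Icc (![(n : ℤ), -(2 * (n : ℤ)), -(2 * (n : ℤ))] : Site 3)
              ![2 * (n : ℤ), 2 * (n : ℤ), 2 * (n : ℤ)] ∧ y 0 = 2 * (n : ℤ)})ᶜ := by
  obtain ⟨K, N, h⟩ := stub_tiling 1 le_rfl
  refine ⟨K, N, fun n hn => ?_⟩
  have hv : (![(n : ℤ), (n : ℤ) + (n / 1 : ℕ), (n : ℤ) + (n / 1 : ℕ)] : Site 3) =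
      ![(n : ℤ), 2 * n, 2 * n] := by
    rw [Nat.div_one, two_mul]
  simpa only [hv] using h n hn

/-- Small scales: `u_n > 0` for each `1 ≤ n ≤ N` (`Negative.blockProb_criticalProb_three_pos`), hence a
common positive lower bound over the finite range (induction on `N`). -/
theorem exists_pos_forall_le_blockProb (N : ℕ) :
    ∃ c : ℝ, 0 < c ∧ ∀ n : ℕ, 1 ≤ n → n ≤ N → c ≤ blockProb 3 (criticalProbI 3) n := by
  induction N with
  | zero => exact ⟨1, one_pos, fun n hn hn0 => by omega⟩
  | succ N ih =>
    obtain ⟨c, hc, h⟩ := ih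
    refine ⟨min c (blockProb 3 (criticalProbI 3) (N + 1)),
      lt_min hc (blockProb_criticalProb_three_pos (Nat.succ_pos N)), fun n hn hnN => ?_⟩
    rcases Nat.lt_or_ge n (N + 1) with hlt | hge
    · exact (min_le_left _ _).trans (h n hn (Nat.lt_succ_iff.mp hlt))
    · obtain rfl : n = N + 1 := le_antisymm hnN hge
      exact min_le_right _ _

end StubBlockerRSWGlue

open StubBlockerRSWGlue in
/-- **Stub `stub_blockerRSWGlue`** (registered signature, verbatim the sibling item
`PercAnnulusCrossing.BlockerRSWGlue`): the blocker-RSW inequality `BlockerRSW3D` and the critical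
cube-blocking seed `CubeBlockingSeed` imply `X_B = CritAnnulusNonCrossing`,
`P_{p_c}(Λ_n ↔ ∂ⁱⁿΛ_{2n} in Λ_{2n}) ≤ 1 - c`. Proof: `f(c₀) ≤ f(q_n) ≤ w_n` at `p_c`; the landed
`stub_tiling` (`k = 1`) and `stub_sixSlab` give `(f(c₀) ^ K) ^ 6 ≤ w_n ^ {6K} ≤ V_n ^ 6 ≤ u_n` for
`n ≥ N`; `u_n > 0` on the finitely many `1 ≤ n < N`; `u_n = 1 - P(annulusCrossing 3 n)`. -/
theorem stub_blockerRSWGlue :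
    (∃ f : ℝ → ℝ, Monotone f ∧ (∀ s, 0 < s → 0 < f s) ∧ ∀ (p : unitInterval) (n : ℕ), 1 ≤ n → f ((bondPercolation (zdGraph 3) p).real {ω | ¬ ∃ x ∈ Finset.Icc (0 : Site 3) ![(n : ℤ), n, n], ∃ y ∈ Finset.Icc (0 : Site 3) ![(n : ℤ), n, n], x 0 = 0 ∧ y 0 = n ∧ ω ∈ openConnIn ↑(Finset.Icc (0 : Site 3) ![(n : ℤ), n, n]) x y}) ≤ (bondPercolation (zdGraph 3) p).real {ω | ¬ ∃ x ∈ Finset.Icc (0 : Site 3) ![(n : ℤ), 2 * n, 2 * n], ∃ y ∈ Finset.Icc (0 : Site 3) ![(n : ℤ), 2 * n, 2 * n], x 0 = 0 ∧ y 0 = n ∧ ω ∈ openConnIn ↑(Finset.Icc (0 : Site 3) ![(n : ℤ), 2 * n, 2 * n]) x y}) → (∃ c : ℝ, 0 < c ∧ ∀ n : ℕ, 1 ≤ n → c ≤ (bondPercolation (zdGraph 3) (criticalProbI 3)).real {ω | ¬ ∃ x ∈ Finset.Icc (0 : Site 3) ![(n : ℤ), n, n], ∃ y ∈ Finset.Icc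 (0 : Site 3) ![(n : ℤ), n, n], x 0 = 0 ∧ y 0 = n ∧ ω ∈ openConnIn ↑(Finset.Icc (0 : Site 3) ![(n : ℤ), n, n]) x y}) → ∃ c : ℝ, 0 < c ∧ ∀ n : ℕ, 1 ≤ n → (bondPercolation (zdGraph 3) (criticalProbI 3)).real {ω | ∃ x ∈ box 3 n, ∃ y ∈ innerBoundary (zdGraph 3) (box 3 (2 * n)), ω ∈ openConnIn ↑(box 3 (2 * n)) x y} ≤ 1 - c := by
  rintro ⟨f, hf_mono, hf_pos, hf⟩ ⟨c₀, hc₀, hseed⟩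
  -- `b := f c₀ > 0` and `b ≤ w_n` at `p_c` for every `n ≥ 1`
  have hb : 0 < f c₀ := hf_pos c₀ hc₀
  have hw : ∀ n : ℕ, 1 ≤ n → f c₀ ≤
      (bondPercolation (zdGraph 3) (criticalProbI 3)).real
        (openCrossing (Set.Icc (0 : Site 3) ![(n : ℤ), 2 * n, 2 * n])
          {x | x ∈ Set.Icc (0 : Site 3) ![(n : ℤ), 2 * n, 2 * n] ∧ x 0 = 0}
          {y | y ∈ Set.Icc (0 : Site 3) ![(n : ℤ), 2 * n, 2 * n] ∧ y 0 = (n : ℤ)})ᶜ := by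
    intro n hn
    rw [← sealEvent_eq]
    exact (hf_mono (hseed n hn)).trans (hf (criticalProbI 3) n hn)
  -- large scales: `(b ^ K) ^ 6 ≤ w_n ^ (6K) ≤ V_n ^ 6 ≤ u_n`
  obtain ⟨K, N, hKN⟩ := tiling_one
  have hlarge : ∀ n : ℕ, 1 ≤ n → N ≤ n → (f c₀ ^ K) ^ 6 ≤ blockProb 3 (criticalProbI 3) n := by
    intro n hn hNn
    calc (f c₀ ^ K) ^ 6
        ≤ ((bondPercolation (zdGraph 3) (criticalProbI 3)).real
            (openCrossing (Set.Icc (0 : Site 3) ![(n : ℤ), 2 * n, 2 * n])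
              {x | x ∈ Set.Icc (0 : Site 3) ![(n : ℤ), 2 * n, 2 * n] ∧ x 0 = 0}
              {y | y ∈ Set.Icc (0 : Site 3) ![(n : ℤ), 2 * n, 2 * n] ∧ y 0 = (n : ℤ)})ᶜ ^ K) ^ 6 :=
          pow_le_pow_left₀ (pow_nonneg hb.le K) (pow_le_pow_left₀ hb.le (hw n hn) K) 6
      _ ≤ (bondPercolation (zdGraph 3) (criticalProbI 3)).real
            (openCrossing (Set.Icc (![(n : ℤ), -(2 * (n : ℤ)), -(2 * (n : ℤ))] : Site 3)
                ![2 * (n : ℤ), 2 * (n : ℤ), 2 * (n : ℤ)])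
              {x | x ∈ Set.Icc (![(n : ℤ), -(2 * (n : ℤ)), -(2 * (n : ℤ))] : Site 3)
                ![2 * (n : ℤ), 2 * (n : ℤ), 2 * (n : ℤ)] ∧ x 0 = (n : ℤ)}
              {y | y ∈ Set.Icc (![(n : ℤ), -(2 * (n : ℤ)), -(2 * (n : ℤ))] : Site 3)
                ![2 * (n : ℤ), 2 * (n : ℤ), 2 * (n : ℤ)] ∧ y 0 = 2 * (n : ℤ)})ᶜ ^ 6 :=
          pow_le_pow_left₀ (pow_nonneg measureReal_nonneg K) (hKN n hNn) 6
      _ ≤ blockProb 3 (criticalProbI 3) n := stub_sixSlab n hn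
  -- small scales: a finite positive minimum
  obtain ⟨c₁, hc₁, hsmall⟩ := exists_pos_forall_le_blockProb N
  refine ⟨min ((f c₀ ^ K) ^ 6) c₁, lt_min (pow_pos (pow_pos hb K) 6) hc₁, fun n hn => ?_⟩
  have hu : min ((f c₀ ^ K) ^ 6) c₁ ≤ blockProb 3 (criticalProbI 3) n := by
    rcases Nat.lt_or_ge n N with hNn | hNn
    · exact (min_le_right _ _).trans (hsmall n hn hNn.le)
    · exact (min_le_left _ _).trans (hlarge n hn hNn)
  -- `u_n = 1 - P(annulusCrossing 3 n)` and the conclusion's event is `annulusCrossing 3 n`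
  rw [blockProb_eq] at hu
  change (bondPercolation (zdGraph 3) (criticalProbI 3)).real (annulusCrossing 3 n) ≤ _
  linarith

namespace StubBlockerRSWGlue

/-- The stub read through the sibling route's item names: `BlockerRSW3D → CubeBlockingSeed →
CritAnnulusNonCrossing` (all three are `def`s of `Theses.PercAnnulusCrossing`; the registered stub
signature is their bodies verbatim, so this is `stub_blockerRSWGlue` itself). This file is a helper of
crux stmt-CriticalPhenomena-4446, not a closure of the sibling item. -/
theorem critAnnulusNonCrossing_of (h₁ : PercAnnulusCrossing.BlockerRSW3D)
    (h₂ : PercAnnulusCrossing.CubeBlockingSeed) : PercAnnulusCrossing.CritAnnulusNonCrossing :=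
  stub_blockerRSWGlue h₁ h₂

/-- Consequently the two sibling items give the crux of this line,
`PercNonProliferation.SubpolynomialBlocking` (`u_n ≥ c > n^{-s}` eventually). -/
theorem subpolynomialBlocking_of (h₁ : PercAnnulusCrossing.BlockerRSW3D)
    (h₂ : PercAnnulusCrossing.CubeBlockingSeed) : PercNonProliferation.SubpolynomialBlocking := by
  -- adapted from the scratch `crux_of_critAnnulusNonCrossing` of the sibling stub `stub_anchor`
  rw [crux_iff, subpolynomialBlockingAt_iff]
  intro s hs
  obtain ⟨c, hc, hbnd⟩ := critAnnulusNonCrossing_of h₁ h₂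
  have hB : ∀ᶠ n : ℕ in atTop, (n : ℝ) ^ (-s) < c :=
    ((tendsto_rpow_neg_atTop hs).comp tendsto_natCast_atTop_atTop).eventually (gt_mem_nhds hc)
  filter_upwards [hB, eventually_ge_atTop 1] with n hB hn
  rw [blockProb_eq]
  have hb' : (bondPercolation (zdGraph 3) (criticalProbI 3)).real (annulusCrossing 3 n) ≤ 1 - c :=
    hbnd n hn
  linarith

end StubBlockerRSWGlue

end Summit.CriticalPhenomena.PercolationContinuityZ3.Theorems.SubpolynomialBlocking

end
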